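import Summits.AtomisticToContinuum.HydrodynamicLimit.Theorems.RelayRaceLocalityNearConstantShortTimeHLCellEstimate
import Summits.AtomisticToContinuum.HydrodynamicLimit.Theorems.RelayRaceLocalityNearConstantShortTimeHLWeightedCell
import Summits.AtomisticToContinuum.HydrodynamicLimit.Theorems.RelayRaceLocalityNearConstantShortTimeHLEulerSide
import Summits.AtomisticToContinuum.HydrodynamicLimit.Theorems.RelayRaceLocalityNearConstantShortTimeHLFlowFubini
import HarnessLib

/-!
# Crux `NearConstantShortTimeHL` (stmt-AtomisticToContinuum-12502), line `small-tilt-domination` — the grid-cell inequality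

Support file for the crux `…Theses.RelayRaceLocality.NearConstantShortTimeHL`, line `small-tilt-domination`
(route `route-AtomisticToContinuum-RelayRaceLocality`: Yau's relative-entropy method, Grönwall inequality discretised over
time cells), registered stub **`grid_cells`** (a package of the skeleton stub `stub_dynamic`).

For an analytic equation-of-state branch on `[0, η₀)`, a classical hard-sphere–Euler solution `(ρ, u, θ)` on `[0, T)`,
`0 < t < T` with packing `ρσ³ < η₀` on `[0, t]`, and `0 < η₁ < η₀`, there is `C > 0` (depending on these data only) such
that for every hard-sphere flow `Φ` of `n ≠ 0` spheres on `𝕋³`, every probability law `P ≪ Liouville`, every grid of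
`ι > 0` cells `[jτ, (j+1)τ]`, `τ = t/ι`, and every measurable good event `G'` on which the ball-packing cap and the
cell-weighted momentum/energy closure defects `≤ d` hold, the entropy deficit
`D(r) = m^{st}(r) − E_P[X_r ∘ Φ_r]` (`m^{st}(r) = ∫ ρ_r (log ρ_r + g_σ(ρ_r) − 3/2 log(2πθ_r) − 3/2)`, `X_r` the log-profile
observable) satisfies on every cell
`∫_{jτ}^{(j+1)τ} D ≤ τ D(jτ) + C τ² + 2 d + C τ (τ (1 + E_P K) + τ C3) + 2 CX τ E_P[(1 + K); G'ᶜ]`.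

Proof: this is the abstract cell estimate `cell_estimate` on the window `[s, s + τ]`, `s = jτ`, fed with
* the pathwise weighted-cell expansion `weightedCell_bound` on `G' ∩ good` (packing cap restricted to the cell);
* the Euler side `integral_logProfileStatic_sub_eq`: `m^{st}(r) − m^{st}(s) = ∫_s^r ∫ eulerRate`, with the rate continuous on
  `[0, t]`, whence `m^{st}` is continuous on the cell and `|m^{st}(r) − m^{st}(s)| ≤ CE (r − s)`, `CE = sup_{[0,t]} |∫ eulerRate|`
  (`gc_euler_cell`);
* Fubini along the flow `integral_integral_flow_swap` for the clamped-measurable observable (dominated by `CX (1 + K)`,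
  `K` conserved along good orbits) and for the cubic moment `n⁻¹ Σᵢ ‖vᵢ‖³ ≤ 2 K + 4 n K²` (`gc_cubic_le`, `gc_flow_swap`),
  the latter giving `E_P ∫_s^{s+τ} n⁻¹ Σ ‖vᵢ(r)‖³ dr ≤ τ C3`.
The constant is `C = C₁ + CE` (`C₁` from `weightedCell_bound`).

No definitions, no named facts. References: H.-T. Yau, Lett. Math. Phys. 22 (1991) §2.
-/

noncomputable section

namespace Summit.AtomisticToContinuum.HydrodynamicLimit.Theorems.NearConstantShortTimeHL

open MeasureTheory Filter Set Topology
open Literature.MathematicalPhysics.KineticTheory Literature.Analysis.FluidPDE Literature.Analysis.FunctionSpaces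
open scoped ENNReal BigOperators

variable {ε : ℝ} {n : ℕ}

/-- **The Euler side on a cell.** Along a classical hard-sphere–Euler solution whose packing stays in the analyticity
band on `[0, t] × 𝕋³`, `t < T`, there is `CE ≥ 0` such that on every window `[a, b] ⊆ [0, t]` the static log-profile mean
`m^{st}(r) = ∫ ρ_r (log ρ_r + g_σ(ρ_r) − 3/2 log(2πθ_r) − 3/2)` is continuous and `|m^{st}(r) − m^{st}(a)| ≤ CE (r − a)`
(`m^{st}(r) − m^{st}(a) = ∫_a^r ∫ eulerRate` with a rate continuous on the compact `[0, t]`, `integral_logProfileStatic_sub_eq`).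
[cite: Yau1991, §2] -/
theorem gc_euler_cell {η₀ : ℝ} {F : ℝ → ℝ} (hη₀ : 0 < η₀)
    (hFa : AnalyticOnNhd ℝ F (Set.Ioo (-η₀) η₀)) (hEq : Set.EqOn hsExcessFreeEnergy F (Set.Ico 0 η₀))
    {σ T : ℝ} (hσ : 0 < σ) {ρ θ : ℝ → T3 → ℝ} {u : ℝ → T3 → V3}
    (hE : IsHardSphereEulerSolution σ T ρ u θ) {t : ℝ} (ht : t ∈ Set.Ico 0 T)
    (hband : ∀ s ∈ Set.Icc 0 t, ∀ x, ρ s x * σ ^ 3 < η₀) :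
    ∃ CE : ℝ, 0 ≤ CE ∧ ∀ {a b : ℝ}, 0 ≤ a → a ≤ b → b ≤ t →
      ContinuousOn (fun r => ∫ x, ρ r x * (Real.log (ρ r x) + gChem σ (ρ r x) -
        3 / 2 * Real.log (2 * Real.pi * θ r x) - 3 / 2)) (Set.Icc a b) ∧
      ∀ r ∈ Set.Icc a b, |(∫ x, ρ r x * (Real.log (ρ r x) + gChem σ (ρ r x) -
          3 / 2 * Real.log (2 * Real.pi * θ r x) - 3 / 2)) -
        ∫ x, ρ a x * (Real.log (ρ a x) + gChem σ (ρ a x) -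
          3 / 2 * Real.log (2 * Real.pi * θ a x) - 3 / 2)| ≤ CE * (r - a) := by
  obtain ⟨hcont, hftc⟩ := integral_logProfileStatic_sub_eq hη₀ hFa hEq hσ hE ht hband
  obtain ⟨C, hC⟩ := isCompact_Icc.exists_bound_of_continuousOn hcont
  refine ⟨max C 0, le_max_right _ _, fun {a b} ha hab hbt => ⟨?_, ?_⟩⟩
  · -- continuity of the primitive
    have hsub : Set.Icc a b ⊆ Set.Icc 0 t := fun r hr => ⟨ha.trans hr.1, hr.2.trans hbt⟩
    have hI : IntervalIntegrable (fun r => ∫ x, eulerRate σ T ρ θ u r x) volume a b :=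
      (hcont.mono hsub).intervalIntegrable_of_Icc hab
    have hprim : ContinuousOn (fun r => ∫ s in a..r, ∫ x, eulerRate σ T ρ θ u s x) (Set.Icc a b) := by
      have h := intervalIntegral.continuousOn_primitive_interval' hI (Set.left_mem_uIcc)
      rwa [Set.uIcc_of_le hab] at h
    refine ((continuousOn_const (c := ∫ x, ρ a x * (Real.log (ρ a x) + gChem σ (ρ a x) -
          3 / 2 * Real.log (2 * Real.pi * θ a x) - 3 / 2))).add hprim).congr fun r hr => ?_
    have h := hftc ha hr.1 (hr.2.trans hbt)
    show _ = (∫ x, ρ a x * (Real.log (ρ a x) + gChem σ (ρ a x) -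
          3 / 2 * Real.log (2 * Real.pi * θ a x) - 3 / 2)) + ∫ s in a..r, ∫ x, eulerRate σ T ρ θ u s x
    linarith
  · intro r hr
    rw [hftc ha hr.1 (hr.2.trans hbt)]
    have hb := intervalIntegral.norm_integral_le_of_norm_le_const (a := a) (b := r) (C := max C 0)
      (f := fun s => ∫ x, eulerRate σ T ρ θ u s x) fun s hs => by
        rw [Set.uIoc_of_le hr.1] at hs
        exact (hC s ⟨ha.trans hs.1.le, hs.2.trans (hr.2.trans hbt)⟩).trans (le_max_left _ _)
    rw [Real.norm_eq_abs, abs_of_nonneg (sub_nonneg.2 hr.1)] at hb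
    exact hb

/-- **The cubic moment is dominated by the kinetic energy.** For `n ≠ 0` spheres,
`n⁻¹ Σᵢ ‖vᵢ‖³ ≤ 2 K + 4 n K²`, `K = n⁻¹ Σᵢ ‖vᵢ‖²/2` (`‖vᵢ‖ ≤ 1 + ‖vᵢ‖² ≤ 1 + Σⱼ ‖vⱼ‖²`). [folklore] -/
theorem gc_cubic_le (hn : n ≠ 0) (w : Config n (Fin 3) T3) :
    (n : ℝ)⁻¹ * ∑ i, ‖(w i).2‖ ^ 3 ≤ 2 * kineticPP w + 4 * n * kineticPP w ^ 2 := by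
  have hn' : (0 : ℝ) < n := Nat.cast_pos.2 (Nat.pos_of_ne_zero hn)
  obtain ⟨S, hS⟩ : ∃ S : ℝ, S = ∑ i, ‖(w i).2‖ ^ 2 := ⟨_, rfl⟩
  have hS0 : 0 ≤ S := hS ▸ Finset.sum_nonneg fun i _ => by positivity
  have hK : kineticPP w = (n : ℝ)⁻¹ * S / 2 := by
    unfold kineticPP
    rw [hS, ← Finset.sum_div, mul_div_assoc]
  have hterm : ∀ i ∈ Finset.univ, ‖(w i).2‖ ^ 3 ≤ ‖(w i).2‖ ^ 2 * (1 + S) := fun i _ => by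
    have h0 : 0 ≤ ‖(w i).2‖ := norm_nonneg _
    have h1 : ‖(w i).2‖ ≤ 1 + ‖(w i).2‖ ^ 2 := by nlinarith [sq_nonneg (‖(w i).2‖ - 1)]
    have h2 : ‖(w i).2‖ ^ 2 ≤ S :=
      hS ▸ Finset.single_le_sum (f := fun j => ‖(w j).2‖ ^ 2) (fun j _ => by positivity) (Finset.mem_univ i)
    calc ‖(w i).2‖ ^ 3 = ‖(w i).2‖ ^ 2 * ‖(w i).2‖ := by ring
      _ ≤ ‖(w i).2‖ ^ 2 * (1 + S) := mul_le_mul_of_nonneg_left (by linarith) (by positivity)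
  have hsum : ∑ i, ‖(w i).2‖ ^ 3 ≤ S * (1 + S) := by
    calc ∑ i, ‖(w i).2‖ ^ 3 ≤ ∑ i, ‖(w i).2‖ ^ 2 * (1 + S) := Finset.sum_le_sum hterm
      _ = S * (1 + S) := by rw [← Finset.sum_mul, ← hS]
  have hSK : S = 2 * n * kineticPP w := by
    rw [hK]
    field_simp
  calc (n : ℝ)⁻¹ * ∑ i, ‖(w i).2‖ ^ 3 ≤ (n : ℝ)⁻¹ * (S * (1 + S)) :=
        mul_le_mul_of_nonneg_left hsum (inv_nonneg.2 hn'.le)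
    _ = 2 * kineticPP w + 4 * n * kineticPP w ^ 2 := by
        rw [hSK]
        field_simp
        ring

/-- The cubic moment `w ↦ n⁻¹ Σᵢ ‖vᵢ‖³` is a measurable function of the configuration (a finite sum of continuous
functions of one velocity coordinate). [folklore] -/
theorem gc_measurable_cubic : Measurable fun w : Config n (Fin 3) T3 => (n : ℝ)⁻¹ * ∑ i, ‖(w i).2‖ ^ 3 := by
  have hv : ∀ i : Fin n, Measurable fun w : Config n (Fin 3) T3 => (w i).2 := fun i =>
    (measurable_pi_apply i).snd
  exact (Finset.measurable_sum _ fun i _ => (hv i).norm.pow_const 3).const_mul _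

/-- **Fubini along the flow, unclamped form.** If a jointly measurable `Y` agrees with the observable `X_r` on the
window `[a, b]` (`Y (r, w) = X_r w` for `r ∈ [a, b]`) and `|X_r (Φ_r z)| ≤ g z` there for good `z` with `g ∈ L¹(P)`,
`P ≪ Liouville` finite, then `z ↦ ∫_a^b X_r (Φ_r z) dr` and every slice are `P`-integrable, `r ↦ E_P X_r ∘ Φ_r` is
interval integrable on `[a, b]`, and `E_P ∫_a^b X_r ∘ Φ_r = ∫_a^b E_P X_r ∘ Φ_r` (`integral_integral_flow_swap` for `Y`,
then replace `Y` by `X` on the window). [folklore] -/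
theorem gc_flow_swap (Φ : HardSphereFlow (Torus.geometry (Fin 3)) ε n) (P : Measure (Config n (Fin 3) T3))
    [IsFiniteMeasure P] (hP : P ≪ liouville (Torus.geometry (Fin 3)) n ε)
    {Y : ℝ × Config n (Fin 3) T3 → ℝ} (hY : Measurable Y) (X : ℝ → Config n (Fin 3) T3 → ℝ) {a b : ℝ}
    (hab : a ≤ b) (hYX : ∀ r ∈ Set.Icc a b, ∀ w, Y (r, w) = X r w)
    {g : Config n (Fin 3) T3 → ℝ} (hg : Integrable g P)
    (hdom : ∀ r ∈ Set.Icc a b, ∀ z ∈ Φ.good, |X r (Φ.flow r z)| ≤ g z) :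
    Integrable (fun z => ∫ r in a..b, X r (Φ.flow r z)) P ∧
      (∀ r ∈ Set.Icc a b, Integrable (fun z => X r (Φ.flow r z)) P) ∧
      IntervalIntegrable (fun r => ∫ z, X r (Φ.flow r z) ∂P) volume a b ∧
      ∫ z, (∫ r in a..b, X r (Φ.flow r z)) ∂P = ∫ r in a..b, ∫ z, X r (Φ.flow r z) ∂P := by
  obtain ⟨h1, h2, h3, h4⟩ := integral_integral_flow_swap Φ P hP hY hab hg
    (fun r hr z hz => by rw [hYX r hr]; exact hdom r hr z hz)
  have hJ : ∀ z, (∫ r in a..b, Y (r, Φ.flow r z)) = ∫ r in a..b, X r (Φ.flow r z) := fun z =>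
    intervalIntegral.integral_congr fun r hr => by
      rw [Set.uIcc_of_le hab] at hr
      exact hYX r hr _
  have hm : Set.EqOn (fun r => ∫ z, Y (r, Φ.flow r z) ∂P) (fun r => ∫ z, X r (Φ.flow r z) ∂P) (Set.Icc a b) :=
    fun r hr => integral_congr_ae (Eventually.of_forall fun z => hYX r hr _)
  refine ⟨?_, fun r hr => ?_, ?_, ?_⟩
  · have e : (fun z => ∫ r in a..b, Y (r, Φ.flow r z)) = fun z => ∫ r in a..b, X r (Φ.flow r z) := funext hJ
    rw [← e]
    exact h1
  · have e : (fun z => Y (r, Φ.flow r z)) = fun z => X r (Φ.flow r z) := funext fun z => hYX r hr _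
    rw [← e]
    exact h2 r hr
  · refine (intervalIntegrable_congr fun r hr => hm ?_).mp h3
    rw [Set.uIoc_of_le hab] at hr
    exact Set.Ioc_subset_Icc_self hr
  · calc ∫ z, (∫ r in a..b, X r (Φ.flow r z)) ∂P = ∫ z, (∫ r in a..b, Y (r, Φ.flow r z)) ∂P :=
          integral_congr_ae (Eventually.of_forall fun z => (hJ z).symm)
      _ = ∫ r in a..b, ∫ z, Y (r, Φ.flow r z) ∂P := h4
      _ = ∫ r in a..b, ∫ z, X r (Φ.flow r z) ∂P :=
          intervalIntegral.integral_congr fun r hr => hm (by rwa [Set.uIcc_of_le hab] at hr)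

/-- **Registered stub `grid_cells`: the per-cell integral inequality of the discretised relative-entropy Grönwall.**
For an analytic EOS branch `F = f_ex` on `[0, η₀)`, a classical hard-sphere–Euler solution on `[0, T)`, `0 < t < T` with
packing `< η₀` on `[0, t]`, `0 < η₁ < η₀`: there is `C > 0` such that for every flow `Φ` of `n ≠ 0` spheres, every
probability law `P ≪ Liouville` with integrable / clamped-measurable / `CX (1 + K)`-bounded log-profile observable,
`K, K² ∈ L¹(P)`, radius `0 < ℓ < 1/2`, cubic-moment bound `C3` along the flow, and a measurable good event `G'` carrying
the packing cap on `[0, t]` and the cell-weighted closure defects `≤ d` of every cell `[jτ, (j+1)τ]`, `τ = t/ι`: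
`∫_{jτ}^{(j+1)τ} D ≤ τ D(jτ) + (C τ² + 2d + C τ (τ (1 + E_P K) + τ C3) + 2 CX τ E_P[(1 + K); G'ᶜ])`,
`D(r) = m^{st}(r) − E_P[X_r ∘ Φ_r]`. Proof: `cell_estimate` on `[jτ, jτ + τ]` with the pathwise expansion
`weightedCell_bound`, the Euler side `gc_euler_cell`, and Fubini along the flow `gc_flow_swap` for the observable and
for the cubic moment (`gc_cubic_le`); `C = C₁ + CE`. [cite: Yau1991, §2] -/
theorem grid_cells : ∀ {η₀ : ℝ} {F : ℝ → ℝ}, 0 < η₀ → AnalyticOnNhd ℝ F (Set.Ioo (-η₀) η₀) → Set.EqOn hsExcessFreeEnergy F (Set.Ico 0 η₀) → ∀ {σ T : ℝ}, 0 < σ → ∀ {ρ θ : ℝ → T3 → ℝ} {u : ℝ → T3 → V3}, IsHardSphereEulerSolution σ T ρ u θ → ∀ {t : ℝ}, t ∈ Set.Ico 0 T → 0 < t → (∀ s ∈ Set.Icc 0 t, ∀ x, ρ s x * σ ^ 3 < η₀) → ∀ {η₁ : ℝ}, 0 < η₁ → η₁ < η₀ → ∃ C : ℝ, 0 < C ∧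 ∀ {ε : ℝ} {n : ℕ} (Φ : HardSphereFlow (Torus.geometry (Fin 3)) ε n), n ≠ 0 → ∀ (P : Measure (Config n (Fin 3) T3)) [IsProbabilityMeasure P], P ≪ liouville (Torus.geometry (Fin 3)) n ε → (∀ r ∈ Set.Icc 0 t, Integrable (fun z => logProfileObs σ ρ θ u r (Φ.flow r z)) P) → Measurable (fun p : ℝ × Config n (Fin 3) T3 => logProfileObs σ ρ θ u (max 0 (min p.1 t)) p.2) → ∀ {CX : ℝ}, 0 ≤ CX → (∀ r ∈ Set.Icc 0 t, ∀ w : Config n (Fin 3) T3, |logProfileObs σ ρ θ u r w| ≤ CX * (1 + kineticPP w)) → Integrable (fun z => kineticPP z) P → Integrable (fun z => kineticPP z ^ 2) P → Measurable (fun w : Config n (Fin 3) T3 => kineticPP w) → ∀ {ℓ : ℝ}, 0 < ℓ → ℓ < 1 / 2 → ∀ {C3 : ℝ}, 0 ≤ C3 → (∀ r ∈ Set.Icc 0 t, Integrable (fun z => (n : ℝ)⁻¹ * ∑ i, ‖((Φ.flow r z) i).2‖ ^ 3) P ∧ ∫ z, (n : ℝ)⁻¹ * ∑ i, ‖((Φ.flow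 r z) i).2‖ ^ 3 ∂P ≤ C3) → ∀ (G' : Set (Config n (Fin 3) T3)), MeasurableSet G' → ∀ {d : ℝ}, 0 ≤ d → ∀ {ι : ℕ}, 0 < ι → (∀ z ∈ G', z ∈ Φ.good → packCapOn Φ z (Set.Icc 0 t) ℓ σ η₁ ∧ ∀ j : ℕ, j < ι → |momDefect σ Φ z ℓ (j * (t / ι)) (t / ι) (fun r y => (j * (t / ι) + t / ι - r) • lamRow θ u r y)| ≤ d ∧ |enDefect σ Φ z ℓ (j * (t / ι)) (t / ι) (fun r y => (j * (t / ι) + t / ι - r) * lam4Row θ r y)| ≤ d) → ∀ j : ℕ, j < ι → (∫ r in (j * (t / ι) : ℝ)..((j + 1) * (t / ι)), ((∫ x, ρ r x * (Real.log (ρ r x) + gChem σ (ρ r x) - 3 / 2 * Real.log (2 * Real.pi * θ r x) - 3 / 2)) - ∫ z, logProfileObs σ ρ θ u r (Φ.flow r z) ∂P)) ≤ t / ι * ((∫ x, ρ (j * (t / ι)) x * (Real.log (ρ (j * (t / ι)) x) + gChem σ (ρ (j * (t / ι)) x) - 3 / 2 * Real.log (2 * Real.pi * θ (j * (t / ι))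 x) - 3 / 2)) - ∫ z, logProfileObs σ ρ θ u (j * (t / ι)) (Φ.flow (j * (t / ι)) z) ∂P) + (C * (t / ι) ^ 2 + 2 * d + C * (t / ι) * ((t / ι) * (1 + ∫ z, kineticPP z ∂P) + (t / ι) * C3) + 2 * CX * (t / ι) * ∫ z in G'ᶜ, (1 + kineticPP z) ∂P) := by
  intro η₀ F hη₀ hFa hEq σ T hσ ρ θ u hE t ht htpos hband η₁ hη₁ hη₁₀
  -- the two solution-level constants
  obtain ⟨C₁, hC₁, hcell⟩ := weightedCell_bound hη₀ hFa hEq hσ hE ht hband hη₁ hη₁₀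
  obtain ⟨CE, hCE, heuler⟩ := gc_euler_cell hη₀ hFa hEq hσ hE ht hband
  refine ⟨C₁ + CE, add_pos_of_pos_of_nonneg hC₁ hCE, ?_⟩
  intro ε n Φ hn P _ hP hXint hXmeas CX hCX hXb hKint hK2int _hKmeas ℓ hℓ0 hℓ C3 hC3 hcub G' hG' d hd ι hι
    hgood j hj
  -- the cell `[s, s + τ]`, `τ = t/ι`, `s = jτ`
  have hι' : (0 : ℝ) < ι := Nat.cast_pos.2 hι
  have hτ : 0 < t / ι := div_pos htpos hι'
  set τ : ℝ := t / ι with hτdef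
  set s : ℝ := (j : ℝ) * τ with hsdef
  have hs : 0 ≤ s := mul_nonneg (Nat.cast_nonneg j) hτ.le
  have hsτ : s ≤ s + τ := le_add_of_nonneg_right hτ.le
  have hst : s + τ ≤ t := by
    have hj' : (j : ℝ) + 1 ≤ ι := by exact_mod_cast Nat.succ_le_of_lt hj
    calc s + τ = ((j : ℝ) + 1) * τ := by rw [hsdef]; ring
      _ ≤ ι * τ := mul_le_mul_of_nonneg_right hj' hτ.le
      _ = t := mul_div_cancel₀ t hι'.ne'
  have hcellI : Set.Icc s (s + τ) ⊆ Set.Icc 0 t := fun r hr => ⟨hs.trans hr.1, hr.2.trans hst⟩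
  have e1 : ((j : ℝ) + 1) * τ = s + τ := by rw [hsdef]; ring
  rw [e1]
  -- (1) the pathwise expansion on `G' ∩ good`
  have hpath : ∀ z ∈ G', z ∈ Φ.good →
      |(∫ r in s..(s + τ), logProfileObs σ ρ θ u r (Φ.flow r z)) - τ * logProfileObs σ ρ θ u s (Φ.flow s z) -
          momDefect σ Φ z ℓ s τ (fun r y => (s + τ - r) • lamRow θ u r y) -
          enDefect σ Φ z ℓ s τ (fun r y => (s + τ - r) * lam4Row θ r y)| ≤
        C₁ * τ * (τ * (1 + kineticPP z) + ∫ r in s..(s + τ), (n : ℝ)⁻¹ * ∑ i, ‖((Φ.flow r z) i).2‖ ^ 3) ∧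
      |momDefect σ Φ z ℓ s τ (fun r y => (s + τ - r) • lamRow θ u r y)| ≤ d ∧
      |enDefect σ Φ z ℓ s τ (fun r y => (s + τ - r) * lam4Row θ r y)| ≤ d := by
    intro z hzG hz
    obtain ⟨hcap, hdef⟩ := hgood z hzG hz
    obtain ⟨hM, hEn⟩ := hdef j hj
    have hcap' : packCapOn Φ z (Set.Icc s (s + τ)) ℓ σ η₁ := fun r hr x => hcap r (hcellI hr) x
    exact ⟨(hcell Φ hz hn hs hτ hst hℓ0 hℓ hcap').2.2, hM, hEn⟩
  -- (2) the Euler side on the cell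
  obtain ⟨hmst, hmstE⟩ := heuler hs hsτ hst
  -- (3) Fubini for the observable (dominated by `CX (1 + K)`, `K` conserved along good orbits)
  have hclamp : ∀ r ∈ Set.Icc s (s + τ), max 0 (min r t) = r := fun r hr => by
    rw [min_eq_left (hcellI hr).2, max_eq_right (hcellI hr).1]
  have hg1 : Integrable (fun z => CX * (1 + kineticPP z)) P := ((integrable_const (1 : ℝ)).add hKint).const_mul CX
  obtain ⟨hJint, -, hmint, hFub⟩ := gc_flow_swap Φ P hP hXmeas (logProfileObs σ ρ θ u) hsτ
    (fun r hr w => by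
      show logProfileObs σ ρ θ u (max 0 (min r t)) w = logProfileObs σ ρ θ u r w
      rw [hclamp r hr])
    hg1 (fun r hr z hz => (hXb r (hcellI hr) _).trans_eq (by rw [wc_kineticPP_flow Φ hz r]))
  -- (4) Fubini for the cubic moment (dominated by `2K + 4nK²`)
  have hg2 : Integrable (fun z => 2 * kineticPP z + 4 * n * kineticPP z ^ 2) P :=
    (hKint.const_mul 2).add (hK2int.const_mul (4 * (n : ℝ)))
  have hcub0 : ∀ w : Config n (Fin 3) T3, 0 ≤ (n : ℝ)⁻¹ * ∑ i, ‖(w i).2‖ ^ 3 := fun w => by positivity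
  obtain ⟨hITint, -, hcmint, hcFub⟩ := gc_flow_swap Φ P hP (gc_measurable_cubic.comp measurable_snd)
    (fun _ w => (n : ℝ)⁻¹ * ∑ i, ‖(w i).2‖ ^ 3) hsτ (fun r _ w => rfl) hg2
    (fun r _ z hz => by
      rw [abs_of_nonneg (hcub0 _)]
      calc (n : ℝ)⁻¹ * ∑ i, ‖((Φ.flow r z) i).2‖ ^ 3
          ≤ 2 * kineticPP (Φ.flow r z) + 4 * n * kineticPP (Φ.flow r z) ^ 2 := gc_cubic_le hn _
        _ = 2 * kineticPP z + 4 * n * kineticPP z ^ 2 := by rw [wc_kineticPP_flow Φ hz r])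
  have hITnn : ∀ z ∈ Φ.good, 0 ≤ ∫ r in s..(s + τ), (n : ℝ)⁻¹ * ∑ i, ‖((Φ.flow r z) i).2‖ ^ 3 :=
    fun z _ => intervalIntegral.integral_nonneg hsτ fun r _ => hcub0 _
  have hITle : (∫ z, (∫ r in s..(s + τ), (n : ℝ)⁻¹ * ∑ i, ‖((Φ.flow r z) i).2‖ ^ 3) ∂P) ≤ τ * C3 := by
    rw [hcFub]
    have hmono := intervalIntegral.integral_mono_on hsτ hcmint intervalIntegrable_const
      fun r hr => (hcub r (hcellI hr)).2
    rwa [intervalIntegral.integral_const, add_sub_cancel_left, smul_eq_mul] at hmono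
  -- (5) the abstract cell estimate
  have key := cell_estimate Φ P hP (s := s) hτ (logProfileObs σ ρ θ u)
    (fun r => ∫ x, ρ r x * (Real.log (ρ r x) + gChem σ (ρ r x) - 3 / 2 * Real.log (2 * Real.pi * θ r x) - 3 / 2))
    (fun _ w => (n : ℝ)⁻¹ * ∑ i, ‖(w i).2‖ ^ 3)
    (fun z => momDefect σ Φ z ℓ s τ (fun r y => (s + τ - r) • lamRow θ u r y))
    (fun z => enDefect σ Φ z ℓ s τ (fun r y => (s + τ - r) * lam4Row θ r y)) G' hG'
    hC₁.le hC3 hCX hCE hd hpath (fun r hr w => hXb r (hcellI hr) w) hmst hmstE (fun _ w => hcub0 w)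
    (fun r hr => hXint r (hcellI hr)) hKint hJint hFub hmint hITint hITnn hITle
  -- (6) enlarge the constants to `C₁ + CE`
  have hK0 : 0 ≤ ∫ z, kineticPP z ∂P := integral_nonneg fun z => by
    show 0 ≤ kineticPP z
    unfold kineticPP
    positivity
  have h1 : 0 ≤ C₁ * τ ^ 2 := by positivity
  have h2 : 0 ≤ CE * τ * (τ * (1 + ∫ z, kineticPP z ∂P) + τ * C3) := by positivity
  linarith

end Summit.AtomisticToContinuum.HydrodynamicLimit.Theorems.NearConstantShortTimeHL

end
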